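import Summits.BirchSwinnertonDyer.BirchSwinnertonDyer.Theorems.SemiOrdinaryEisensteinDescentWildSplitEisensteinInclusionAtThreeStubSaturate
import Summits.BirchSwinnertonDyer.BirchSwinnertonDyer.Theorems.CongruentShaFreeCutUnrSeriesWeierstrass
import Mathlib.RingTheory.PowerSeries.WeierstrassPreparation
import HarnessLib

/-!
# Crux E `WildSplitEisensteinInclusionAtThree` (stmt-BirchSwinnertonDyer-20479), line `birth`: the LEVER in
# WEIERSTRASS currency — `L ∣ 3^k·g for some k` ⟺ the `3`-primitive part `L₀` of `L` divides `g` ⟺ the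
# distinguished polynomial `P_L` of `L` divides `g`; hence the lever forces `λ(L) ≤ λ(g)`
# — HELPER (`--supports 20479`), width seat bsd-wall-soed-p1-w2 g0; ROUTE-FREE (no `Theses` import)

Route `SemiOrdinaryEisensteinDescent` (SOED), cell `pub/bsd-wall`. The registered lever
`stub_semiOrdinaryTransferUpToPPower` of crux E concludes, for the PRINCIPAL ideal `I = Ch_Λ(X_(∅,0))·R₀⟦T⟧ = (g)`
(companion file `…LeverCurrency`, `charIdeal_map_eq_span`) and a frame `L`, that `∃ k, L ∣ 3^k·g`
(`…LeverCurrency.lever_span_iff_exists_dvd`). This file reads that statement through the structure theory of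
`R₀⟦T⟧` (`R₀ = unrIntegers 3`, a complete DVR with uniformiser `3`: tree `isDiscreteValuationRing_unrIntegers`,
`CongruentShaFreeCutUnrSeriesWeierstrass.isAdicComplete_maximalIdeal`; Mathlib's Weierstrass preparation
`PowerSeries.exists_isWeierstrassFactorization`). Pure commutative algebra; nothing about elliptic curves; no
definition, no named fact, no `sorry`.

* §1 **`3`-content and unit coefficients.** `L₀` has non-zero reduction mod `3` iff some coefficient of `L₀` is a
  unit of `R₀` (`exists_isUnit_coeff_iff_map_residue_ne_zero`); every `L ≠ 0` is `3^μ·L₀` with such an `L₀`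
  (`exists_eq_pow_mul_of_ne_zero`, from the tree's `UnrSeries.exists_eq_C_pow_mul_map_residue_ne_zero`), and
  further `L = 3^μ·P·h` with `P` a DISTINGUISHED polynomial and `h` a unit (`exists_eq_pow_mul_distinguished_mul_unit`).
* §2 **LEVER ⟺ `L₀ ∣ g`.** If `L = 3^μ·L₀` and `L₀` has a unit coefficient, then
  `(∃ k, L ∣ 3^k·g) ↔ L₀ ∣ g` (`exists_dvd_pow_mul_iff_primitive_dvd`: saturation at `3`, p545527, one way;
  `k = μ` the other). So the lever ignores exactly the `3`-content `3^μ` of `L` (its `μ`-invariant) and nothing else,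
  while the crux's own inclusion `(g) ⊆ (L)` is `L ∣ g` (`Ideal.span_singleton_le_span_singleton`).
* §3 **LEVER ⟺ `P_L ∣ g`.** With `L = 3^μ·P·h` as in §1, `(∃ k, L ∣ 3^k·g) ↔ (P : R₀⟦T⟧) ∣ g`
  (`exists_dvd_pow_mul_iff_distinguished_dvd`) — «the distinguished polynomial of the `p`-adic `L`-function divides
  the characteristic power series», the classical statement of a main-conjecture divisibility "without `μ`".
* §4 **The lever forces `λ(L) ≤ λ(g)`.** A distinguished polynomial dividing another distinguished polynomial (times
  a unit, times a power of `3`) in `R₀⟦T⟧` has smaller degree (`natDegree_le_of_distinguished_dvd`,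
  `natDegree_le_of_exists_dvd_pow_mul`): the lever implies the λ-inequality `λ_an ≤ λ_alg`, the converse half of
  the norm-profile DOMINANCE of `…LeverCurrency` §3 (equality of `λ` ⟸ lever + Kolyvagin inclusion).
* §5 **`Σ`-cancellation.** Eisenstein-congruence engines output `Σ`-IMPRIMITIVE inclusions; when both sides carry
  the same non-zero correction factor `P_Σ` it cancels (`exists_dvd_pow_mul_of_mul_dvd`, `dvd_of_mul_dvd_mul`).

HONEST STATUS: crux E is NOT closed; nothing here is progress on the lever's ENGINE (no Eisenstein congruences at
a supercuspidal `π₃` in print); BSD is not proved for any curve. Supports, does not close,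
stmt-BirchSwinnertonDyer-20479.

References: [Washington1997] §7.1 (Thm. 7.3, Lemma 7.5; `μ`, `λ`, distinguished polynomials); [SerreLocalFields1979]
Ch. II §5.
-/

set_option autoImplicit false
set_option linter.dupNamespace false -- `Summit.BirchSwinnertonDyer.BirchSwinnertonDyer.Theorems.…` (summit = sub)

noncomputable section

open scoped Classical

namespace Summit.BirchSwinnertonDyer.BirchSwinnertonDyer.Theorems.WildSplitEisensteinInclusionAtThreeLeverWeierstrass

open PowerSeries Literature.NumberTheory.EllipticCurves
  Summit.BirchSwinnertonDyer.Rank1Residual.X2.HidaLimitAlgebra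
  Summit.BirchSwinnertonDyer.BirchSwinnertonDyer.Theorems.WildSplitEisensteinInclusionAtThreeSaturate
  Summit.BirchSwinnertonDyer.BirchSwinnertonDyer.Theorems.CongruentShaFreeCutUnrSeriesWeierstrass

/-! ### §1 `3`-content, unit coefficients, Weierstrass decomposition -/

/-- `(3 : R₀⟦T⟧)^μ = C(3^μ)`. [folklore] -/
theorem three_pow_eq_C (μ : ℕ) :
    (3 : UnrSeries 3) ^ μ = PowerSeries.C ((3 : unrIntegers 3) ^ μ) := by
  rw [map_pow, map_ofNat]

/-- `((3 : ℕ) : R₀) = 3`. [folklore] -/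
theorem natCast_three : ((3 : ℕ) : unrIntegers 3) = 3 := by norm_num

/-- **Non-zero reduction ⟺ a unit coefficient** (under the DVR structure of `R₀`, maximal ideal `(3)`): `L₀ mod 3 ≠ 0`
in `k⟦T⟧` iff some coefficient of `L₀` is a unit of `R₀`. [folklore] -/
theorem exists_isUnit_coeff_iff_map_residue_ne_zero (L₀ : UnrSeries 3) :
    (∃ n : ℕ, IsUnit (PowerSeries.coeff n L₀)) ↔
      (haveI := isDiscreteValuationRing_unrIntegers (p := 3);
        L₀.map (IsLocalRing.residue (unrIntegers 3)) ≠ 0) := by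
  haveI := isDiscreteValuationRing_unrIntegers (p := 3)
  constructor
  · rintro ⟨n, hn⟩ h
    have h1 : PowerSeries.coeff n (L₀.map (IsLocalRing.residue (unrIntegers 3))) = 0 := by rw [h, map_zero]
    rw [PowerSeries.coeff_map] at h1
    exact (IsLocalRing.residue_ne_zero_iff_isUnit _).mpr hn h1
  · intro h
    by_contra hne
    push Not at hne
    apply h
    ext n
    rw [PowerSeries.coeff_map, map_zero]
    by_contra h2
    exact hne n ((IsLocalRing.residue_ne_zero_iff_isUnit _).mp h2)

/-- **`3`-content extraction**: every `L ≠ 0` in `R₀⟦T⟧` is `3^μ·L₀` with `L₀` having a unit coefficient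
(`μ = μ(L)`; tree `UnrSeries.exists_eq_C_pow_mul_map_residue_ne_zero`). [cite: Washington1997, §7.1 (Lemma 7.5)] -/
theorem exists_eq_pow_mul_of_ne_zero {L : UnrSeries 3} (hL : L ≠ 0) :
    ∃ (μ : ℕ) (L₀ : UnrSeries 3), L = (3 : UnrSeries 3) ^ μ * L₀ ∧ ∃ n : ℕ, IsUnit (PowerSeries.coeff n L₀) := by
  obtain ⟨μ, L₀, hμ, hres⟩ := UnrSeries.exists_eq_C_pow_mul_map_residue_ne_zero (p := 3) hL
  refine ⟨μ, L₀, ?_, (exists_isUnit_coeff_iff_map_residue_ne_zero L₀).mpr hres⟩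
  rw [hμ, three_pow_eq_C, natCast_three]

/-- **Weierstrass decomposition in `R₀⟦T⟧`**: every `L ≠ 0` is `3^μ · P · h` with `P ∈ R₀[T]` DISTINGUISHED at `(3)`
(monic, lower coefficients divisible by `3`) and `h` a unit of `R₀⟦T⟧` — `3`-content extraction followed by
Mathlib's Weierstrass preparation over the complete local ring `R₀` (tree `isAdicComplete_maximalIdeal`).
`deg P = λ(L)`, `μ = μ(L)`. [cite: Washington1997, §7.1 (Thm. 7.3)] -/
theorem exists_eq_pow_mul_distinguished_mul_unit {L : UnrSeries 3} (hL : L ≠ 0) :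
    ∃ (μ : ℕ) (P : Polynomial (unrIntegers 3)) (h : UnrSeries 3),
      P.IsDistinguishedAt (Ideal.span {(3 : unrIntegers 3)}) ∧ IsUnit h ∧
        L = (3 : UnrSeries 3) ^ μ * ((P : UnrSeries 3) * h) := by
  haveI := isDiscreteValuationRing_unrIntegers (p := 3)
  haveI := isAdicComplete_maximalIdeal (p := 3)
  obtain ⟨μ, L₀, hμ, hres⟩ := UnrSeries.exists_eq_C_pow_mul_map_residue_ne_zero (p := 3) hL
  obtain ⟨P, h, hfac⟩ := PowerSeries.exists_isWeierstrassFactorization hres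
  have hmax : IsLocalRing.maximalIdeal (unrIntegers 3) = Ideal.span {(3 : unrIntegers 3)} := by
    rw [maximalIdeal_eq_span_p (p := 3), natCast_three]
  refine ⟨μ, P, h, hmax ▸ hfac.isDistinguishedAt, hfac.isUnit, ?_⟩
  rw [hμ, three_pow_eq_C, natCast_three, hfac.eq_mul]

/-- A distinguished polynomial, seen in `R₀⟦T⟧`, has a unit coefficient (its leading coefficient `1`). [folklore] -/
theorem exists_isUnit_coeff_coe_of_monic {P : Polynomial (unrIntegers 3)} (hP : P.Monic) :
    ∃ n : ℕ, IsUnit (PowerSeries.coeff n (P : UnrSeries 3)) :=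
  ⟨P.natDegree, by rw [Polynomial.coeff_coe, hP.coeff_natDegree]; exact isUnit_one⟩

/-- A unit coefficient survives multiplication by a unit of `R₀⟦T⟧` (reduction mod `3` is multiplicative and `k⟦T⟧`
has no zero divisors). [folklore] -/
theorem exists_isUnit_coeff_mul_of_isUnit {L₀ h : UnrSeries 3} (hL₀ : ∃ n : ℕ, IsUnit (PowerSeries.coeff n L₀))
    (hh : IsUnit h) : ∃ n : ℕ, IsUnit (PowerSeries.coeff n (L₀ * h)) := by
  haveI := isDiscreteValuationRing_unrIntegers (p := 3)
  rw [exists_isUnit_coeff_iff_map_residue_ne_zero] at hL₀ ⊢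
  rw [map_mul]
  exact mul_ne_zero hL₀ (IsUnit.ne_zero (hh.map _))

/-! ### §2 The lever ⟺ divisibility by the `3`-primitive part -/

/-- **LEVER ⟺ `L₀ ∣ g`.** If `L = 3^μ·L₀` with `L₀` having a unit coefficient, then for every `g`:
`(∃ k, L ∣ 3^k·g) ↔ L₀ ∣ g`. (⟹: `L₀ ∣ 3^k·g`, saturate at `3` — `mem_span_of_pow_three_mul_mem_span`, p545527;
⟸: `k = μ`.) The lever discards exactly the `3`-content `3^{μ(L)}`. [cite: Washington1997, §7.1] -/
theorem exists_dvd_pow_mul_iff_primitive_dvd {L L₀ : UnrSeries 3} {μ : ℕ} (hL : L = (3 : UnrSeries 3) ^ μ * L₀)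
    (hL₀ : ∃ n : ℕ, IsUnit (PowerSeries.coeff n L₀)) (g : UnrSeries 3) :
    (∃ k : ℕ, L ∣ (3 : UnrSeries 3) ^ k * g) ↔ L₀ ∣ g := by
  constructor
  · rintro ⟨k, hk⟩
    have h1 : L₀ ∣ (3 : UnrSeries 3) ^ k * g := (Dvd.intro_left _ hL.symm).trans hk
    exact Ideal.mem_span_singleton.mp
      (mem_span_of_pow_three_mul_mem_span L₀ hL₀ k g (Ideal.mem_span_singleton.mpr h1))
  · rintro ⟨q, rfl⟩
    exact ⟨μ, ⟨q, by rw [hL]; ring⟩⟩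

/-- **The crux's own inclusion is plain divisibility**: `(g) ⊆ (L) ↔ L ∣ g` (Mathlib), recorded next to the lever's
`L₀ ∣ g` for comparison: crux = lever + `3^{μ(L)} ∣ g/L₀`. [folklore] -/
theorem span_le_span_iff_dvd (g L : UnrSeries 3) :
    Ideal.span ({g} : Set (UnrSeries 3)) ≤ Ideal.span {L} ↔ L ∣ g :=
  Ideal.span_singleton_le_span_singleton

/-- With `μ(L) = 0` (`L` itself has a unit coefficient) the lever and the crux's inclusion coincide:
`(∃ k, L ∣ 3^k·g) ↔ L ∣ g`. [cite: Washington1997, §7.1] -/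
theorem exists_dvd_pow_mul_iff_dvd_of_exists_isUnit_coeff {L : UnrSeries 3}
    (hL : ∃ n : ℕ, IsUnit (PowerSeries.coeff n L)) (g : UnrSeries 3) :
    (∃ k : ℕ, L ∣ (3 : UnrSeries 3) ^ k * g) ↔ L ∣ g :=
  exists_dvd_pow_mul_iff_primitive_dvd (μ := 0) (by rw [pow_zero, one_mul]) hL g

/-! ### §3 The lever ⟺ divisibility by the distinguished polynomial -/

/-- **LEVER ⟺ `P_L ∣ g`.** If `L = 3^μ·P·h` with `P` monic (e.g. distinguished) and `h` a unit of `R₀⟦T⟧`, then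
`(∃ k, L ∣ 3^k·g) ↔ (P : R₀⟦T⟧) ∣ g`: «the distinguished polynomial of `L` divides the characteristic power
series» — the classical form of a main-conjecture divisibility without its `μ`-part.
[cite: Washington1997, §7.1 (Thm. 7.3)] -/
theorem exists_dvd_pow_mul_iff_distinguished_dvd {L h : UnrSeries 3} {P : Polynomial (unrIntegers 3)} {μ : ℕ}
    (hL : L = (3 : UnrSeries 3) ^ μ * ((P : UnrSeries 3) * h)) (hP : P.Monic) (hh : IsUnit h)
    (g : UnrSeries 3) :
    (∃ k : ℕ, L ∣ (3 : UnrSeries 3) ^ k * g) ↔ (P : UnrSeries 3) ∣ g := by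
  rw [exists_dvd_pow_mul_iff_primitive_dvd hL
    (exists_isUnit_coeff_mul_of_isUnit (exists_isUnit_coeff_coe_of_monic hP) hh) g]
  obtain ⟨u, rfl⟩ := hh
  exact Units.mul_right_dvd

/-! ### §4 The lever forces `λ(L) ≤ λ(g)` -/

/-- **Distinguished ∣ distinguished ⟹ degree inequality.** If `P`, `Q ∈ R₀[T]` are distinguished at `(3)` and
`(P : R₀⟦T⟧) ∣ (Q : R₀⟦T⟧)`, then `deg P ≤ deg Q`: reduce mod `3`, where `P ↦ T^{deg P}`, `Q ↦ T^{deg Q}`, and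
compare `T`-orders in `k⟦T⟧`. [cite: Washington1997, §7.1] -/
theorem natDegree_le_of_distinguished_dvd {P Q : Polynomial (unrIntegers 3)}
    (hP : P.IsDistinguishedAt (Ideal.span {(3 : unrIntegers 3)}))
    (hQ : Q.IsDistinguishedAt (Ideal.span {(3 : unrIntegers 3)}))
    (hdvd : (P : UnrSeries 3) ∣ (Q : UnrSeries 3)) : P.natDegree ≤ Q.natDegree := by
  obtain ⟨r, hr⟩ := hdvd
  set I : Ideal (unrIntegers 3) := Ideal.span {(3 : unrIntegers 3)} with hI
  -- the residue ring `k = R₀/(3)` is non-trivial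
  have h3 : Prime (3 : unrIntegers 3) := prime_three_unrIntegers
  haveI : I.IsPrime := (Ideal.span_singleton_prime h3.ne_zero).mpr h3
  haveI : Nontrivial (unrIntegers 3 ⧸ I) := Ideal.Quotient.nontrivial_iff.mpr Ideal.IsPrime.ne_top'
  -- reduce `Q = P * r` modulo `3`
  have hred : (PowerSeries.X : PowerSeries (unrIntegers 3 ⧸ I)) ^ Q.natDegree =
      PowerSeries.X ^ P.natDegree * r.map (Ideal.Quotient.mk I) := by
    have h := congrArg (PowerSeries.map (Ideal.Quotient.mk I)) hr
    rw [map_mul, ← Polynomial.polynomial_map_coe, ← Polynomial.polynomial_map_coe, hP.map_eq_X_pow,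
      hQ.map_eq_X_pow, Polynomial.coe_pow, Polynomial.coe_pow, Polynomial.coe_X] at h
    exact h
  -- compare orders
  have hord := PowerSeries.le_order_mul ((PowerSeries.X : PowerSeries (unrIntegers 3 ⧸ I)) ^ P.natDegree)
    (r.map (Ideal.Quotient.mk I))
  rw [← hred, PowerSeries.order_X_pow, PowerSeries.order_X_pow] at hord
  have h2 : (P.natDegree : ℕ∞) ≤ (Q.natDegree : ℕ∞) := le_trans le_self_add hord
  exact_mod_cast h2

/-- **LEVER ⟹ `λ(L) ≤ λ(g)`.** With Weierstrass decompositions `L = 3^μ·P·h` and `g = 3^ν·Q·h'` (`P`, `Q`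
distinguished, `h`, `h'` units; `deg P = λ(L)`, `deg Q = λ(g)`): if `L ∣ 3^k·g` for some `k` then `deg P ≤ deg Q`.
(`P ∣ g = 3^ν·Q·h'` by §3; saturate `P ∣ 3^ν·(Q·h')` at `3` — `P` is monic —; drop the unit `h'`; §4.) So the
lever carries the λ-inequality `λ_an ≤ λ_alg`; with the Kolyvagin inclusion it is the λ-EQUALITY.
[cite: Washington1997, §7.1] -/
theorem natDegree_le_of_exists_dvd_pow_mul {L h g h' : UnrSeries 3} {P Q : Polynomial (unrIntegers 3)} {μ ν : ℕ}
    (hL : L = (3 : UnrSeries 3) ^ μ * ((P : UnrSeries 3) * h))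
    (hP : P.IsDistinguishedAt (Ideal.span {(3 : unrIntegers 3)})) (hh : IsUnit h)
    (hg : g = (3 : UnrSeries 3) ^ ν * ((Q : UnrSeries 3) * h'))
    (hQ : Q.IsDistinguishedAt (Ideal.span {(3 : unrIntegers 3)})) (hh' : IsUnit h')
    (hlever : ∃ k : ℕ, L ∣ (3 : UnrSeries 3) ^ k * g) : P.natDegree ≤ Q.natDegree := by
  have hPg : (P : UnrSeries 3) ∣ g := (exists_dvd_pow_mul_iff_distinguished_dvd hL hP.monic hh g).mp hlever
  -- `P ∣ 3^ν · (Q · h')`, saturate at `3`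
  have hPQh : (P : UnrSeries 3) ∣ (Q : UnrSeries 3) * h' := by
    rw [hg] at hPg
    exact Ideal.mem_span_singleton.mp (mem_span_of_pow_three_mul_mem_span (P : UnrSeries 3)
      (exists_isUnit_coeff_coe_of_monic hP.monic) ν _ (Ideal.mem_span_singleton.mpr hPg))
  -- drop the unit `h'`
  have hPQ : (P : UnrSeries 3) ∣ (Q : UnrSeries 3) := by
    obtain ⟨u, rfl⟩ := hh'
    exact Units.dvd_mul_right.mp hPQh
  exact natDegree_le_of_distinguished_dvd hP hQ hPQ

/-! ### §5 `Σ`-cancellation -/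

/-- **Cancellation of a common non-zero factor, integral form**: `L·c ∣ g·c`, `c ≠ 0` ⟹ `L ∣ g` (`R₀⟦T⟧` is a
domain). In use: `c = ∏_{w ∈ Σ}` (anticyclotomic Euler factors), the same on the algebraic and the analytic side of
a `Σ`-imprimitive main-conjecture inclusion. [folklore] -/
theorem dvd_of_mul_dvd_mul {L g c : UnrSeries 3} (hc : c ≠ 0) (h : L * c ∣ g * c) : L ∣ g :=
  (mul_dvd_mul_iff_right hc).mp h

/-- **Cancellation of a common non-zero factor, lever form**: `(∃ k, L·c ∣ 3^k·(g·c))`, `c ≠ 0` ⟹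
`∃ k, L ∣ 3^k·g`. [folklore] -/
theorem exists_dvd_pow_mul_of_mul_dvd {L g c : UnrSeries 3} (hc : c ≠ 0)
    (h : ∃ k : ℕ, L * c ∣ (3 : UnrSeries 3) ^ k * (g * c)) : ∃ k : ℕ, L ∣ (3 : UnrSeries 3) ^ k * g := by
  obtain ⟨k, hk⟩ := h
  refine ⟨k, dvd_of_mul_dvd_mul hc ?_⟩
  rwa [mul_assoc]

end Summit.BirchSwinnertonDyer.BirchSwinnertonDyer.Theorems.WildSplitEisensteinInclusionAtThreeLeverWeierstrass

end
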